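import Summits.Ventures.YMGap.Thresholds.RegionHessian
import Summits.Ventures.YMGap.Thresholds.WilsonHessian

/-!
# Venture YMGap — Theorem C on `ℤ^d` with frozen exterior, calculus half: the second variation of
# the regional Wilson sum along an exponential curve is `regionHess`, hence at most `4d ‖X‖²`

HONEST FRAMING: venture file (cell `pub-ymgap`, track (a), item A2, uniqueness leg). Sibling of
`RegionHessian` (the inequality `|regionHess| ≤ 4d Σ_{e∈E} ‖X_e‖²`): here the dictionary with the
second derivative, exactly as `WilsonHessian` did on the torus — for unitary links `Q` on `ℤ^d` and
skew-Hermitian `X` vanishing off the finite edge set `E`,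
`|d²/dt²|₀ Σ_{p ∩ E ≠ ∅} Re tr((e^{tX₁}Q₁)(e^{tX₂}Q₂)(e^{tX₃}Q₃)ᴴ(e^{tX₄}Q₄)ᴴ)| ≤ 4d Σ_{e∈E} ‖X_e‖²`
(`abs_region_second_variation_le_four_d`), via `ExpWordCalculus.hasDerivAt_reTrWord` /
`hasDerivAt_deriv_reTrWord_zero` summed over the finite set `plaquettesTouching E`. This is the
Hessian input of the Bakry–Émery criterion for the DLR kernels `γ_E(· | η)`, uniform in `E` and
`η`; no measure, threshold or uniqueness statement is made in this file.

Reference: cell files `p2/SPL-SOS.md` §3; H. Shen, R. Zhu, X. Zhu, CMP 400 (2023) 805, (4.3),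
Lemma 4.1, Remark 1.3.
-/

noncomputable section

namespace Summit.Ventures.YMGap.HessianSharp

open Matrix Complex NormedSpace Finset
open Literature.MathematicalPhysics.QuantumLattice
open Literature.Probability.LatticeModels (Site)
open scoped Matrix ComplexConjugate BigOperators

variable {n : Type*} [Fintype n] [DecidableEq n] {d : ℕ}

/-! ## Calculus: the second variation of the regional Wilson sum is `regionHess` -/

/-- The exponentially perturbed configuration on `ℤ^d`, `Q^t_e = e^{tX_e} Q_e`. -/
def zperturb (Q X : LGConfig d (Matrix n n ℂ)) (t : ℝ) : LGConfig d (Matrix n n ℂ) :=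
  fun e => exp (t • X e) * Q e

/-- `Re tr(Q₁ Q₂ Q₃ᴴ Q₄ᴴ)` for the plaquette `(x; i, j)` of `ℤ^d` (`= Re tr hol_p` for unitary
links, the word of `plaquetteHolonomyZd`). -/
def zplaqRe (Q : LGConfig d (Matrix n n ℂ)) (x : Site d) (i j : Fin d) : ℝ :=
  (Q (x, i) * Q (x + Pi.single i 1, j) * (Q (x + Pi.single j 1, i))ᴴ * (Q (x, j))ᴴ).trace.re

/-- The regional Wilson sum `Σ_{p ∩ E ≠ ∅} Re tr(Q₁Q₂Q₃ᴴQ₄ᴴ)` (the potential of the DLR kernel of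
`E`, up to the factor `Nβ`, sign and an additive constant). -/
def regionRe (Q : LGConfig d (Matrix n n ℂ)) (E : Finset (ZdEdge d)) : ℝ :=
  ∑ p ∈ plaquettesTouching E, zplaqRe Q p.1 p.2.1.1 p.2.1.2

/-- The first variation of one plaquette term along `Q^t = e^{tX}Q`, as a function of `t`. -/
def zplaqReDeriv (Q X : LGConfig d (Matrix n n ℂ)) (x : Site d) (i j : Fin d) (t : ℝ) : ℝ :=
  reTrWord (1 * X (x, i)) (X (x, i)) (Q (x, i)) (X (x + Pi.single i 1, j))
      (Q (x + Pi.single i 1, j) * (Q (x + Pi.single j 1, i))ᴴ) (-X (x + Pi.single j 1, i))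
      (Q (x, j))ᴴ (-X (x, j)) 1 t
    + reTrWord 1 (X (x, i)) (Q (x, i) * X (x + Pi.single i 1, j)) (X (x + Pi.single i 1, j))
      (Q (x + Pi.single i 1, j) * (Q (x + Pi.single j 1, i))ᴴ) (-X (x + Pi.single j 1, i))
      (Q (x, j))ᴴ (-X (x, j)) 1 t
    + reTrWord 1 (X (x, i)) (Q (x, i)) (X (x + Pi.single i 1, j))
      (Q (x + Pi.single i 1, j) * (Q (x + Pi.single j 1, i))ᴴ * -X (x + Pi.single j 1, i))
      (-X (x + Pi.single j 1, i)) (Q (x, j))ᴴ (-X (x, j)) 1 t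
    + reTrWord 1 (X (x, i)) (Q (x, i)) (X (x + Pi.single i 1, j))
      (Q (x + Pi.single i 1, j) * (Q (x + Pi.single j 1, i))ᴴ) (-X (x + Pi.single j 1, i))
      ((Q (x, j))ᴴ * -X (x, j)) (-X (x, j)) 1 t

/-- Along the perturbation, one plaquette term is the exponential word of `ExpWordCalculus` with
`V = (X₁, X₂, -X₃, -X₄)`, `B = (Q₁, Q₂Q₃ᴴ, Q₄ᴴ, 1)` (skew-Hermitian `X₃, X₄`). -/
theorem zplaqRe_perturb_eq (Q X : LGConfig d (Matrix n n ℂ)) (x : Site d) (i j : Fin d)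
    (h₃ : (X (x + Pi.single j 1, i))ᴴ = -X (x + Pi.single j 1, i)) (h₄ : (X (x, j))ᴴ = -X (x, j))
    (t : ℝ) :
    zplaqRe (zperturb Q X t) x i j =
      reTrWord 1 (X (x, i)) (Q (x, i)) (X (x + Pi.single i 1, j))
        (Q (x + Pi.single i 1, j) * (Q (x + Pi.single j 1, i))ᴴ)
        (-X (x + Pi.single j 1, i)) (Q (x, j))ᴴ (-X (x, j)) 1 t := by
  simp only [zplaqRe, zperturb, reTrWord, expWord, conjTranspose_mul,
    conjTranspose_exp_smul_of_skew h₃, conjTranspose_exp_smul_of_skew h₄, Matrix.one_mul,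
    Matrix.mul_one, Matrix.mul_assoc]

/-- The first variation of one plaquette term has derivative `zplaqHess` at `t = 0`. -/
theorem hasDerivAt_zplaqReDeriv_zero (Q X : LGConfig d (Matrix n n ℂ)) (x : Site d) (i j : Fin d) :
    HasDerivAt (zplaqReDeriv Q X x i j) (zplaqHess Q X x i j) 0 :=
  hasDerivAt_deriv_reTrWord_zero (X (x, i)) (Q (x, i)) (X (x + Pi.single i 1, j))
    (Q (x + Pi.single i 1, j) * (Q (x + Pi.single j 1, i))ᴴ) (-X (x + Pi.single j 1, i))
    (Q (x, j))ᴴ (-X (x, j)) 1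

/-- **First variation** of the regional sum along `Q^t = e^{tX}Q` (skew-Hermitian `X`). -/
theorem hasDerivAt_regionRe_perturb (Q X : LGConfig d (Matrix n n ℂ)) (E : Finset (ZdEdge d))
    (hX : ∀ e, (X e)ᴴ = -X e) (t : ℝ) :
    HasDerivAt (fun s => regionRe (zperturb Q X s) E)
      (∑ p ∈ plaquettesTouching E, zplaqReDeriv Q X p.1 p.2.1.1 p.2.1.2 t) t := by
  have hfun : (fun s => regionRe (zperturb Q X s) E) = fun s => ∑ p ∈ plaquettesTouching E,
      reTrWord 1 (X (p.1, p.2.1.1)) (Q (p.1, p.2.1.1)) (X (p.1 + Pi.single p.2.1.1 1, p.2.1.2))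
        (Q (p.1 + Pi.single p.2.1.1 1, p.2.1.2) * (Q (p.1 + Pi.single p.2.1.2 1, p.2.1.1))ᴴ)
        (-X (p.1 + Pi.single p.2.1.2 1, p.2.1.1)) (Q (p.1, p.2.1.2))ᴴ (-X (p.1, p.2.1.2)) 1 s := by
    funext s
    unfold regionRe
    exact Finset.sum_congr rfl fun p _ => zplaqRe_perturb_eq Q X p.1 p.2.1.1 p.2.1.2 (hX _) (hX _) s
  rw [hfun]
  exact HasDerivAt.fun_sum fun p _ =>
    hasDerivAt_reTrWord 1 (X (p.1, p.2.1.1)) (Q (p.1, p.2.1.1)) (X (p.1 + Pi.single p.2.1.1 1, p.2.1.2))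
      (Q (p.1 + Pi.single p.2.1.1 1, p.2.1.2) * (Q (p.1 + Pi.single p.2.1.2 1, p.2.1.1))ᴴ)
      (-X (p.1 + Pi.single p.2.1.2 1, p.2.1.1)) (Q (p.1, p.2.1.2))ᴴ (-X (p.1, p.2.1.2)) 1 t

/-- The derivative function of the regional sum along the perturbation. -/
theorem deriv_regionRe_perturb (Q X : LGConfig d (Matrix n n ℂ)) (E : Finset (ZdEdge d))
    (hX : ∀ e, (X e)ᴴ = -X e) :
    deriv (fun s => regionRe (zperturb Q X s) E) =
      fun t => ∑ p ∈ plaquettesTouching E, zplaqReDeriv Q X p.1 p.2.1.1 p.2.1.2 t :=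
  funext fun t => (hasDerivAt_regionRe_perturb Q X E hX t).deriv

/-- **Second variation = `regionHess`** (skew-Hermitian directions, any `Q`). -/
theorem iteratedDeriv_two_regionRe (Q X : LGConfig d (Matrix n n ℂ)) (E : Finset (ZdEdge d))
    (hX : ∀ e, (X e)ᴴ = -X e) :
    iteratedDeriv 2 (fun t => regionRe (zperturb Q X t) E) 0 = regionHess Q X E := by
  rw [iteratedDeriv_succ, iteratedDeriv_one, deriv_regionRe_perturb Q X E hX]
  exact (HasDerivAt.fun_sum fun p _ => hasDerivAt_zplaqReDeriv_zero Q X p.1 p.2.1.1 p.2.1.2).deriv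

/-- **Theorem C with frozen exterior, assembled.** On `ℤ^d` (any `d`, any `n`), for unitary links
`Q` (interior AND exterior), skew-Hermitian directions `X` vanishing off the finite edge set `E`:
the second variation at `t = 0` of `t ↦ Σ_{p ∩ E ≠ ∅} Re tr hol_p(e^{tX}Q)` is at most
`4d Σ_{e∈E} ‖X_e‖²` in absolute value. For the DLR kernel of `E` at tree coupling `Nβ` (potential
`Nβ ×` this sum) this is `|Hess| ≤ 4dN|β| |v|²` uniformly in the region and the boundary condition
(SZZ Lemma 4.1 gives `8(d-1)N|β|` by the same termwise count). -/
theorem abs_region_second_variation_le_four_d (Q X : LGConfig d (Matrix n n ℂ))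
    (hQ : ∀ e, Q e ∈ Matrix.unitaryGroup n ℂ) (hX : ∀ e, (X e)ᴴ = -X e) (E : Finset (ZdEdge d))
    (hXE : ∀ e ∉ E, X e = 0) :
    |iteratedDeriv 2 (fun t => regionRe (zperturb Q X t) E) 0| ≤ 4 * d * regionNormSq X E := by
  rw [iteratedDeriv_two_regionRe Q X E hX]
  exact abs_regionHess_le_four_d Q X hQ E hXE

end Summit.Ventures.YMGap.HessianSharp
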